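import Summits.CriticalPhenomena.Ising3DConformalLimit.Theorems.PerfectScreeningCoulombImpliesNontrivialSusceptibilityOfIsotherm
import Summits.CriticalPhenomena.Ising3DConformalLimit.Theorems.SubPtolemyFloor.Negative.TransferCostume
import HarnessLib

/-!
# `SubPtolemyFloor` (item stmt-CriticalPhenomena-15703): the critical-isotherm currency of the round-2 idea
# `box-hyperscaling-isotherm` is the integrated currency in costume (Fisher / Buckingham–Gunton)

Negative / structural knowledge about the crux
`Summit.CriticalPhenomena.Ising3DConformalLimit.Theses.SubPtolemyInterlacing.SubPtolemyFloor`
(route SubPtolemyInterlacing, r3), from the crux-triage panel (round 2, triager 2; evidence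
`Cruxes/SubPtolemyFloor/TRIAGE-r2-2.md`); THEOREM-ONLY, no new definitions.
Notation: `G(x) = ⟨σ₀σ_x⟩_{β_c(3)}`, `χ_n = Σ_{x ∈ Λ_n} G(x)`, `m(h) = ⟨σ₀⟩⁺_{β_c,h} = magnetizationInField 3 β_c h`,
`L = log₂(1+√2) = 1.27155…`.

The card transports the crux to the critical isotherm: `IsothermFloor(δ₀, c) : ∀ h ∈ (0,1], c·h^{1/δ₀} ≤ m(h)` with
`δ₀ > 1 + 4/L = 4.1458` (main line, via Tasaki and `MirrorBox`) or `δ₀ > 6/L - 1 = 3.7187` (lossless sibling, via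
`ZeemanFloor`). This file records that the isotherm currency is the crux's own INTEGRATED currency read through
Fisher's inequality, so that nothing is relocated:

* `criticalTwoPoint_le_plusExpect_spinPair` (GKS: `G(x) ≤ ⟨σ₀σ_x⟩⁺_{β_c,h}` for `h ≥ 0`) and
  `boxSum_criticalTwoPoint_le_mag` — **Fisher / Buckingham–Gunton in finite-size form**:
  `χ_n ≤ |Λ_n|·m(h)² + m(h)/(β_c h)` for every `n` and `h > 0` (the truncated sum is `≤ m/(β_c h)` by the weak
  GHS bound, tree `sum_plusTrunc_le_mag_div`). This is the `d = 3` lattice form of `2 - η ≤ d(δ-1)/(δ+1)`.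
* `isothermFloor_of_susceptibilityFloor` — **`SusceptibilityFloor(a₀) ⇒ IsothermFloor(δ₀ = (6-a₀)/a₀)`**
  (`0 < a₀ < 3`; optimise at `n ≍ h^{-2/(6-a₀)}`): lossless under scaling (`a₀ = 1.0363 ↦ δ = 4.790`); it maps the
  thermodynamic frontier `δ = 3` to `a₀ = 3/2` and the DEAD Sketch engine `a₀ < 3L/(2+L) = 1.1661` to exactly the
  card's `δ₀ > 1 + 4/L`.
* `isothermFloor_of_crux` — **the crux implies `IsothermFloor(δ₀)` for some `δ₀ > 6/L - 1`**: the thermodynamic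
  factor of the card's lossless sibling is NECESSARY for the crux (modulo its `ZeemanFloor`, the sibling's transfer
  is an equivalence), and the main line's `δ₀ > 1 + 4/L` is the image of the dead integrated engine, not a weaker ask.

References: M. E. Fisher, Phys. Rev. 180 (1969) 594 (rigorous exponent inequalities, `(2-η) ≤ d(δ-1)/(δ+1)`);
M. J. Buckingham, J. D. Gunton, Phys. Rev. 178 (1969) 848; S. Friedli, Y. Velenik, *Statistical Mechanics of
Lattice Systems* (2017), §3.6–3.7 (GKS, GHS for the plus state).
-/

noncomputable section

namespace Summit.CriticalPhenomena.Ising3DConformalLimit.SubPtolemyFloorNegative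

open scoped BigOperators Classical
open Finset Literature.Probability.LatticeModels
open Summit.CriticalPhenomena.Ising3DConformalLimit.Theses.SubPtolemyInterlacing
open Summit.CriticalPhenomena.Ising3DConformalLimit.PerfectScreeningCoulombImpliesNontrivial

/-! ## §D box-hyperscaling-isotherm: the isotherm floor is the integrated floor through Fisher's inequality -/

/-- **GKS in the field**: `G(x) = ⟨σ₀σ_x⟩⁺_{β_c,0} ≤ ⟨σ₀σ_x⟩⁺_{β_c,h}` for `h ≥ 0`. [cite: FriedliVelenik2017, Lemma 3.31, p. 119] -/
theorem criticalTwoPoint_le_plusExpect_spinPair {h : ℝ} (hh : 0 ≤ h) (x : Site 3) :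
    criticalTwoPoint 3 x ≤ plusExpect 3 (criticalBeta 3) h (spinPair 0 x) := by
  by_cases hx : x = 0
  · subst hx
    have h1 : plusExpect 3 (criticalBeta 3) h (fun _ => (1 : ℝ)) = 1 := by
      simp only [plusExpect, isingExpect_const]
      exact tendsto_const_nhds.limUnder_eq
    simp only [criticalTwoPoint_zero', spinPair_self, h1, le_refl]
  · have hpair : ∀ h' : ℝ,
        plusExpect 3 (criticalBeta 3) h' (spinPair 0 x) = plusCorr 3 (criticalBeta 3) h' {0, x} := by
      intro h'
      rw [plusCorr]
      congr 1
      funext s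
      simp [spinPair, spinProduct, Finset.prod_insert, Ne.symm hx]
    have h0 : criticalTwoPoint 3 x = plusExpect 3 (criticalBeta 3) 0 (spinPair 0 x) := rfl
    rw [h0, hpair 0, hpair h]
    exact plusCorr_mono_params (criticalBeta_nonneg 3) le_rfl le_rfl hh _

/-- **Fisher / Buckingham–Gunton, finite-size form**: for every `n` and `h > 0`,
`χ_n = Σ_{x∈Λ_n} G(x) ≤ |Λ_n|·m(β_c,h)² + m(β_c,h)/(β_c h)` (GKS in the field, then the weak GHS susceptibility
bound `Σ_{x∈Λ}(⟨σ₀σ_x⟩⁺_h - m²) ≤ m/(βh)`). [cite: Fisher1969, Phys. Rev. 180, 594, inequality (2-η) ≤ d(δ-1)/(δ+1) and its proof] -/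
theorem boxSum_criticalTwoPoint_le_mag {h : ℝ} (hh : 0 < h) (n : ℕ) :
    ∑ x ∈ box 3 n, criticalTwoPoint 3 x ≤
      (#(box 3 n) : ℝ) * magnetizationInField 3 (criticalBeta 3) h ^ 2 +
        magnetizationInField 3 (criticalBeta 3) h / (criticalBeta 3 * h) := by
  have hβ : 0 < criticalBeta 3 := criticalBeta_pos_holds (d := 3) (by norm_num)
  have hghs := sum_plusTrunc_le_mag_div (d := 3) hβ hh (box 3 n)
  calc ∑ x ∈ box 3 n, criticalTwoPoint 3 x
      ≤ ∑ x ∈ box 3 n, plusExpect 3 (criticalBeta 3) h (spinPair 0 x) :=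
        Finset.sum_le_sum fun x _ => criticalTwoPoint_le_plusExpect_spinPair hh.le x
    _ = (#(box 3 n) : ℝ) * magnetizationInField 3 (criticalBeta 3) h ^ 2 +
          ∑ x ∈ box 3 n, (plusExpect 3 (criticalBeta 3) h (spinPair 0 x) -
            magnetizationInField 3 (criticalBeta 3) h ^ 2) := by
        rw [Finset.sum_sub_distrib, Finset.sum_const, nsmul_eq_mul]; ring
    _ ≤ (#(box 3 n) : ℝ) * magnetizationInField 3 (criticalBeta 3) h ^ 2 +
          magnetizationInField 3 (criticalBeta 3) h / (criticalBeta 3 * h) := by linarith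

/-- The same with `|Λ_n| = (2n+1)³ ≤ 27 n³` for `n ≥ 1`. [folklore] -/
theorem boxSum_criticalTwoPoint_le_mag' {h : ℝ} (hh : 0 < h) {n : ℕ} (hn : 1 ≤ n) :
    ∑ x ∈ box 3 n, criticalTwoPoint 3 x ≤
      27 * (n : ℝ) ^ 3 * magnetizationInField 3 (criticalBeta 3) h ^ 2 +
        magnetizationInField 3 (criticalBeta 3) h / (criticalBeta 3 * h) := by
  have h1 := boxSum_criticalTwoPoint_le_mag hh n
  have hn1 : (1 : ℝ) ≤ n := by exact_mod_cast hn
  have hcard : (#(box 3 n) : ℝ) ≤ 27 * (n : ℝ) ^ 3 := by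
    have h3 : (2 * (n : ℝ) + 1) ^ 3 ≤ (3 * (n : ℝ)) ^ 3 :=
      pow_le_pow_left₀ (by positivity) (by linarith) 3
    calc (#(box 3 n) : ℝ) = (2 * (n : ℝ) + 1) ^ 3 := by
          simp only [card_box, Nat.cast_pow, Nat.cast_add, Nat.cast_mul, Nat.cast_ofNat, Nat.cast_one]
      _ ≤ (3 * (n : ℝ)) ^ 3 := h3
      _ = 27 * (n : ℝ) ^ 3 := by ring
  have hm2 : 0 ≤ magnetizationInField 3 (criticalBeta 3) h ^ 2 := sq_nonneg _
  nlinarith [mul_le_mul_of_nonneg_right hcard hm2]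

/-- **`SusceptibilityFloor(a₀) ⇒ IsothermFloor(δ₀ = (6-a₀)/a₀)`**: if `χ_n ≥ c n^{3-a₀}` for all `n ≥ 1`
(`0 < a₀ < 3`), then `m(β_c,h) ≥ c' h^{a₀/(6-a₀)}` for `0 < h ≤ 1`. Proof: at `N = ⌈h^{-2/(6-a₀)}⌉` the Fisher
inequality `c N^{3-a₀} ≤ 27N³m² + m/(β_c h)` forces either `m² ≳ N^{-a₀}` or `m ≳ h N^{3-a₀}`, both `≳ h^{2a₀/(6-a₀)}`
resp. `h^{a₀/(6-a₀)}`. Lossless under scaling: `a₀ = 1 + η ↦ δ = (5-η)/(1+η)`. [cite: Fisher1969, Phys. Rev. 180, 594, inequality (2-η) ≤ d(δ-1)/(δ+1) and its proof] -/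
theorem isothermFloor_of_susceptibilityFloor {a₀ c : ℝ} (ha0 : 0 < a₀) (ha3 : a₀ < 3) (hc : 0 < c)
    (hS : ∀ n : ℕ, 1 ≤ n → c * (n : ℝ) ^ (3 - a₀) ≤ ∑ x ∈ box 3 n, criticalTwoPoint 3 x) :
    ∃ c' : ℝ, 0 < c' ∧ ∀ h : ℝ, 0 < h → h ≤ 1 →
      c' * h ^ (a₀ / (6 - a₀)) ≤ magnetizationInField 3 (criticalBeta 3) h := by
  have hβ : 0 < criticalBeta 3 := criticalBeta_pos_holds (d := 3) (by norm_num)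
  have h6 : 0 < 6 - a₀ := by linarith
  set θ : ℝ := 2 / (6 - a₀) with hθ
  have hθ0 : 0 < θ := by positivity
  set e : ℝ := a₀ / (6 - a₀) with he
  have he0 : 0 < e := by positivity
  -- exponent identities
  have heA : -θ * -a₀ = e * ((2 : ℕ) : ℝ) := by
    rw [hθ, he]; push_cast; field_simp
  have heB : 1 + -θ * (3 - a₀) = e := by
    rw [hθ, he]; field_simp; ring
  set c₁ : ℝ := Real.sqrt (c * (2 : ℝ) ^ (-a₀) / 54) with hc₁
  set c₂ : ℝ := criticalBeta 3 * c / 2 with hc₂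
  have hc₁0 : 0 < c₁ := by positivity
  have hc₂0 : 0 < c₂ := by positivity
  refine ⟨min c₁ c₂, lt_min hc₁0 hc₂0, fun h hh hh1 => ?_⟩
  set m := magnetizationInField 3 (criticalBeta 3) h with hm
  have hm0 : 0 ≤ m := by
    rw [hm, magnetizationInField_eq_plusCorr]; exact plusCorr_nonneg hβ.le hh.le _
  have hhe : 0 < h ^ e := Real.rpow_pos_of_pos hh e
  -- the scale `N = ⌈X⌉`, `X = h^{-θ} ≥ 1`
  set X : ℝ := h ^ (-θ) with hX
  have hX0 : 0 < X := Real.rpow_pos_of_pos hh _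
  have hX1 : 1 ≤ X := Real.one_le_rpow_of_pos_of_le_one_of_nonpos hh hh1 (by linarith)
  set N : ℕ := ⌈X⌉₊ with hN
  have hNX : X ≤ (N : ℝ) := Nat.le_ceil X
  have hN1r : (1 : ℝ) ≤ (N : ℝ) := hX1.trans hNX
  have hN1 : 1 ≤ N := by exact_mod_cast hN1r
  have hN0 : (0 : ℝ) < N := by linarith
  have hN2 : (N : ℝ) ≤ 2 * X := by
    have := Nat.ceil_lt_add_one hX0.le
    linarith
  -- Fisher at scale N
  have key : c * (N : ℝ) ^ (3 - a₀) ≤ 27 * (N : ℝ) ^ 3 * m ^ 2 + m / (criticalBeta 3 * h) :=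
    (hS N hN1).trans (boxSum_criticalTwoPoint_le_mag' hh hN1)
  have hsplit : (N : ℝ) ^ (3 - a₀) = (N : ℝ) ^ 3 * (N : ℝ) ^ (-a₀) := by
    rw [sub_eq_add_neg, Real.rpow_add hN0, ← Real.rpow_natCast]; norm_num
  by_cases hA : c * (N : ℝ) ^ (3 - a₀) / 2 ≤ 27 * (N : ℝ) ^ 3 * m ^ 2
  · -- Case A: `m² ≥ (c/54) N^{-a₀} ≥ (c/54) (2X)^{-a₀} = c₁² h^{2e}`
    have hA1 : c * (N : ℝ) ^ (-a₀) / 54 ≤ m ^ 2 := by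
      rw [hsplit] at hA
      have hN3 : 0 < (N : ℝ) ^ 3 := by positivity
      have : (N : ℝ) ^ 3 * (c * (N : ℝ) ^ (-a₀) / 54) ≤ (N : ℝ) ^ 3 * m ^ 2 := by nlinarith
      exact le_of_mul_le_mul_left this hN3
    have hmono : (2 * X) ^ (-a₀) ≤ (N : ℝ) ^ (-a₀) :=
      Real.rpow_le_rpow_of_nonpos hN0 hN2 (by linarith)
    have h2X : (2 * X) ^ (-a₀) = (2 : ℝ) ^ (-a₀) * (h ^ e) ^ 2 := by
      rw [Real.mul_rpow (by norm_num) hX0.le, hX, ← Real.rpow_mul hh.le, heA, Real.rpow_mul hh.le,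
        Real.rpow_natCast]
    have hsq : (c₁ * h ^ e) ^ 2 ≤ m ^ 2 := by
      calc (c₁ * h ^ e) ^ 2 = c * (2 : ℝ) ^ (-a₀) / 54 * (h ^ e) ^ 2 := by
            rw [mul_pow, hc₁, Real.sq_sqrt (by positivity)]
        _ = c * ((2 : ℝ) ^ (-a₀) * (h ^ e) ^ 2) / 54 := by ring
        _ = c * (2 * X) ^ (-a₀) / 54 := by rw [h2X]
        _ ≤ c * (N : ℝ) ^ (-a₀) / 54 := by
            apply div_le_div_of_nonneg_right _ (by norm_num)
            exact mul_le_mul_of_nonneg_left hmono hc.le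
        _ ≤ m ^ 2 := hA1
    have hc1e : c₁ * h ^ e ≤ m :=
      (pow_le_pow_iff_left₀ (by positivity) hm0 two_ne_zero).1 hsq
    calc min c₁ c₂ * h ^ e ≤ c₁ * h ^ e := mul_le_mul_of_nonneg_right (min_le_left _ _) hhe.le
      _ ≤ m := hc1e
  · -- Case B: `m ≥ (β_c h)(c/2) N^{3-a₀} ≥ c₂ h X^{3-a₀} = c₂ h^e`
    have hB : c * (N : ℝ) ^ (3 - a₀) / 2 ≤ m / (criticalBeta 3 * h) := by linarith [not_le.mp hA]
    rw [le_div_iff₀ (by positivity)] at hB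
    have hmono : X ^ (3 - a₀) ≤ (N : ℝ) ^ (3 - a₀) :=
      Real.rpow_le_rpow hX0.le hNX (by linarith)
    have hXe : h * X ^ (3 - a₀) = h ^ e := by
      rw [hX, ← Real.rpow_mul hh.le, ← heB, Real.rpow_add hh, Real.rpow_one]
    have hc2e : c₂ * h ^ e ≤ m := by
      calc c₂ * h ^ e = c * X ^ (3 - a₀) / 2 * (criticalBeta 3 * h) := by
            rw [← hXe, hc₂]; ring
        _ ≤ c * (N : ℝ) ^ (3 - a₀) / 2 * (criticalBeta 3 * h) := by
            apply mul_le_mul_of_nonneg_right _ (by positivity)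
            apply div_le_div_of_nonneg_right _ (by norm_num)
            exact mul_le_mul_of_nonneg_left hmono hc.le
        _ ≤ m := hB
    calc min c₁ c₂ * h ^ e ≤ c₂ * h ^ e := mul_le_mul_of_nonneg_right (min_le_right _ _) hhe.le
      _ ≤ m := hc2e

/-- `6/L - 1 < 6/a - 1` for `0 < a < L`. [folklore] -/
theorem six_div_sub_one_lt {a : ℝ} (ha0 : 0 < a) (haL : a < Real.logb 2 (1 + Real.sqrt 2)) :
    6 / Real.logb 2 (1 + Real.sqrt 2) - 1 < 6 / a - 1 := by
  have := div_lt_div_of_pos_left (by norm_num : (0:ℝ) < 6) ha0 haL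
  linarith

/-- **COSTUME (box-hyperscaling-isotherm, thermodynamic factor).** The crux implies the critical-isotherm floor
`m(β_c,h) ≥ c·h^{1/δ₀}` on `(0,1]` for some `δ₀ > 6/L - 1 = 3.7187…` — exactly the threshold of the card's lossless
sibling (`ZeemanFloor ∧ IsothermFloor(δ₀ > 6/L-1) ⇒ crux`), so modulo `ZeemanFloor` that transfer is an
equivalence; the main line's `δ₀ > 1 + 4/L` is the image of the dead integrated engine `a₀ < 3L/(2+L)` under the
same map `δ₀ = 6/a₀ - 1`. (`crux ⇒ SusceptibilityFloor(a)`, `susceptibilityFloor_of_crux`; then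
`isothermFloor_of_susceptibilityFloor`.) [folklore] -/
theorem isothermFloor_of_crux (hF : SubPtolemyFloor) :
    ∃ δ₀ c : ℝ, 6 / Real.logb 2 (1 + Real.sqrt 2) - 1 < δ₀ ∧ 0 < c ∧ ∀ h : ℝ, 0 < h → h ≤ 1 →
      c * h ^ (1 / δ₀) ≤ magnetizationInField 3 (criticalBeta 3) h := by
  obtain ⟨a₀, ha1, haL, c, hc, hS⟩ := susceptibilityFloor_of_crux hF
  have ha3 : a₀ < 3 := haL.trans (SubPtolemyFloorNegative.threshold_lt_two.trans (by norm_num))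
  obtain ⟨c', hc', hI⟩ := isothermFloor_of_susceptibilityFloor (by linarith) ha3 hc hS
  refine ⟨6 / a₀ - 1, c', six_div_sub_one_lt (by linarith) haL, hc', fun h hh hh1 => ?_⟩
  have ha0' : (a₀ : ℝ) ≠ 0 := by positivity
  have he : (1 : ℝ) / (6 / a₀ - 1) = a₀ / (6 - a₀) := by
    rw [div_sub_one ha0', one_div_div]
  rw [he]
  exact hI h hh hh1

/-- The number `6/L - 1` exceeds the rigorous `δ = 3` (`L < 3/2`), and `1 + 4/L > 6/L - 1` (`L > 1`): the main
line asks MORE of the isotherm than the crux returns. [folklore] -/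
theorem isotherm_thresholds :
    3 < 6 / Real.logb 2 (1 + Real.sqrt 2) - 1 ∧
      6 / Real.logb 2 (1 + Real.sqrt 2) - 1 < 1 + 4 / Real.logb 2 (1 + Real.sqrt 2) := by
  have h1 := SubPtolemyFloorNegative.one_lt_threshold
  have h2 := SubPtolemyFloorNegative.threshold_lt_three_halves
  set L := Real.logb 2 (1 + Real.sqrt 2) with hL
  have hL0 : 0 < L := by linarith
  constructor
  · rw [lt_sub_iff_add_lt, lt_div_iff₀ hL0]; nlinarith
  · have : 6 / L - 4 / L = 2 / L := by ring
    have h3 : 2 / L < 2 := by rw [div_lt_iff₀ hL0]; linarith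
    linarith

end Summit.CriticalPhenomena.Ising3DConformalLimit.SubPtolemyFloorNegative

end
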